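import Literature.Computability.AlgebraicComplexity.LMR13TangentAtDet
import Literature.Computability.AlgebraicComplexity.LMR13ImmanantHessianForm
import Literature.Computability.AlgebraicComplexity.LMR13ImmanantsTangent
import Literature.Computability.AlgebraicComplexity.LMR13DetHessianKernel
import Literature.RepresentationTheory.FiniteGroups.SymmetricGroupFourTermClassFunctions
import Literature.Computability.AlgebraicComplexity.LMR13Prop342Assembly
import Mathlib.LinearAlgebra.Matrix.Transvection
import Mathlib.LinearAlgebra.Matrix.Permutation
import HarnessLib

/-!
# LMR 2013 Lemma 3.4.1 (the four-term character relations), hence Prop. 3.4.2: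
# `P_n = {1ⁿ, 21^{n−2}}` — the named fact `LMR2013_prop_3_4_2` DISCHARGED

Cell val-lit (D-0074), row LMR13-A; lead-lmr ladder item (X7) (seat val-lit-p7 g3), the last rung of
the (Zar) ladder of Landsberg–Manivel–Ressayre 2013, §3.3–3.4 (journal pp. 477–480 = arXiv:1004.4802
`p0006.txt:L57`–`p0008.txt:L40`): (Z0) `LMR13FirstOrderIdentity` (val-lit-t17), (Z1)/(Z2)
`LMR13ZariskiTangentDivisibility`, (Zarb)/Lemma 3.3.2 `LMR13TangentAtDet` (val-lit-p7), Lemma 3.3.1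
`LMR13DetHessianKernel` and the immanant Hessian form `LMR13ImmanantHessianForm` (val-lit-t10), the
`⊇` half `LMR13ImmanantsTangent` (val-lit-t11), the four-term class functions
`SymmetricGroupFourTermClassFunctions`, the `n = 3` certificate `LMR13PermanentNotTangentThree` and
the assembly `LMR13Prop342Assembly` (val-lit-p8).

## Results

* `LMR2013_lemma_3_4_1` — **LMR Lemma 3.4.1** (p. 479): if `IM_λ ∈ T̂_{[det_n]}𝒟ual_{2n−2,n,n²}` then
  for every `σ` and pairwise distinct `a, c, k, m`,
  `χ_λ(σ) + χ_λ(σ(ac)) + χ_λ(σ(km)) + χ_λ(σ(ac)(km)) = 0`;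
  `spechtCharacter_mem_fourTermClassFunctions_of_immanant_mem` — the same as `χ_λ ∈ C_n` (`n ≥ 4`).
* `LMR2013_prop_3_4_2_of_four_le` — **Prop. 3.4.2 for `n ≥ 4`**, and
  **`LMR2013_prop_3_4_2_holds : LMR2013_prop_3_4_2`** — the named fact of `LMR13DualVarieties.lean`
  (typed `n ≥ 3`) HOLDS (the `n = 3` clause through val-lit-p8's `LMR2013_prop_3_4_2_of_lemma_3_4_1`).

## Proof of Lemma 3.4.1 (ours; a rigorous replacement of the printed coefficient argument)

The printed proof (arXiv `p0007.txt:L58`–`p0008.txt:L8`) substitutes a generic parametrisation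
`(w′, μ, ζ)` of the pairs (corank-one `w`, `X ∈ (H_{det_n,w})_{sing}`) into Lemma 3.3.2, argues that
"`IM_λ(w′,μ) = 0 ⟹ IM_λ(ζ,w′,μ) = 0`, both homogeneous of degree `n` in `w′`, hence proportional"
(this needs an irreducibility of `IM_λ(w′,μ)` in `w′` which is not discussed — recorded on the cell's
print ledger by val-lit-t10/lead-lmr), and reads the relations off the coefficient of `ζ_i^pζ_i^q`
(where, in addition, the `p ↔ q`-symmetric term contributes a second coset `σ⟨(ip),(qn)⟩(in)`, so
monomial by monomial one obtains eight-term sums). We avoid all of this by evaluating at ONE sparse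
point per relation: for `σ` and pairwise distinct `a, c, k, m` put

  `w = Σ_{j≠m} E_{j,σ(j)} + E_{k,σ(m)} + E_{m,σ(k)} + E_{m,σ(m)} = T_{mk} Λ_m T_{km} P_σ` (`fourTermW`),
  `X = E_{a,σ(c)} + E_{c,σ(a)} = T_{mk} (E_{ac} + E_{ca}) T_{km} P_σ`                (`fourTermX`).

Then `rank w = n − 1` (`rank_fourTermW`), `X` is in the kernel of `Hess det_n(w)` (transport of the
radical to `Λ_m`, where `E_{ac} + E_{ca}` has zero `m`-th row, column and diagonal — LMR Lemma 3.3.1),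
so Lemma 3.3.2 gives `c_{X,w}` with `Xᵀ·H_π(w)·X = c_{X,w}·π(w)` for EVERY tangent vector `π`. The
products `∏_i w_{iρ(i)}` along a permutation `ρ` vanish unless `ρ ∈ {σ, σ(km)}` (`forall_compat_iff`),
whence (`eval_fourTermW_immanant`, `dotProduct_hessianMatrix_immanant_fourTerm`)

  `IM_λ(w) = χ_λ(σ) + χ_λ(σ(km))`,  `Xᵀ·H_{IM_λ}(w)·X = 2(χ_λ(σ(ac)) + χ_λ(σ(ac)(km)))`,

and for the orbit tangent vector `π₁ = x_{kσ(k)}·∂_{(m,σ(m))} det_n ∈ 𝔤𝔩·det_n ⊆ T̂`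
(`glTangent_detPoly_subset_lmrZariskiTangent`)

  `π₁(w) = sgn σ`,  `Xᵀ·H_{π₁}(w)·X = Xᵀ·H_{∂det}(w)·X = 2·sgn(σ(ac)) = −2·sgn σ`

(`eval_fourTermW_orbitVector`, `dotProduct_hessianMatrix_pderiv_detPoly_fourTerm`; the only permutation
feeding the mixed third derivative `∂_{(a,σc)}∂_{(c,σa)}∂_{(m,σm)} det_n` at `w` is `σ(ac)`). Hence
`c_{X,w} = −2` and `2(χ(σ(ac)) + χ(σ(ac)(km))) = −2(χ(σ) + χ(σ(km)))`, which is Lemma 3.4.1 — no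
generic point, no proportionality, no `ζ`-coefficients. (The same evaluations of the immanant side
against explicit entry hypotheses are in val-lit-p8's `LMR13ImmanantSparsePoint.lean`, found
independently in parallel; this file's versions are stated for the matrices `fourTermW`/`fourTermX`
defined here as products, which is what the rank and kernel statements use.)

Theorems, plus the two definitions `fourTermW`, `fourTermX` of the special point; no named facts.
Honest framing: this closes a 2013 representation-theoretic lemma about the determinant orbit
closure's tangent space (an input of LMR Thm. 3.1.1 "`𝒟ual` is smooth at `[det_n]`"); it says nothing
about `dc(per_m)`, and VP ≠ VNP is NOT proved — nothing here is progress on it.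

## References

* J. M. Landsberg, L. Manivel, N. Ressayre, *Hypersurfaces with degenerate duals and the geometric
  complexity theory program*, Comment. Math. Helv. 88 (2013) 469–484, Lemma 3.4.1 and Prop. 3.4.2
  (pp. 479–480), Lemma 3.3.1–3.3.2 (p. 478); arXiv:1004.4802 `p0007.txt:L18`–`p0008.txt:L40`.
  [cite: LandsbergManivelRessayre2013, Lemma 3.4.1 (p. 479); Proposition 3.4.2 (p. 479)]

## Tree

`exists_hessianQuadratic_eq_mul_eval_of_mem_lmrZariskiTangent_detPoly` (`LMR13TangentAtDet`);
`hessianMatrix_detPoly_mulVec_eq_zero_iff_of_mul_mul`, `hessianMatrix_detPoly_lamMatrix_mulVec_eq_zero_iff`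
(`LMR13DetHessianKernel`); `dotProduct_hessianMatrix_immanant_mulVec`, `pderiv_prod_X_perm_row`
(`LMR13ImmanantHessianForm`); `detPoly_eq_sum_sign_smul_prod`, `LMR2013_prop_3_4_2_mpr`
(`LMR13ImmanantsTangent`); `glTangent_detPoly_subset_lmrZariskiTangent` (`LMR13ZariskiTangentProofs`);
`fourTermClassFunctions`, `spechtCharacter_mem_fourTermClassFunctions_iff`
(`SymmetricGroupFourTermClassFunctions`); `LMR2013_prop_3_4_2_of_lemma_3_4_1` (`LMR13Prop342Assembly`);
`lamMatrix`, `rank_lamMatrix` (`LandsbergRessayreNormalForm`); `spechtCharacter_conj`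
(`SymmetricGroupReps`). Mathlib: `Matrix.transvection`, `Equiv.Perm.permMatrix`, `Matrix.det_permutation`,
`Matrix.rank_mul_eq_left/right_of_isUnit_det`, `Equiv.Perm.Disjoint.commute`, `Equiv.Perm.sign_swap`.
-/

noncomputable section

open MvPolynomial Matrix

namespace Literature.Computability.AlgebraicComplexity

open _root_.Literature.NumberTheory.DiophantineGeometry _root_.Literature.RepresentationTheory.FiniteGroups

variable {n : ℕ}

/-! ### The special point `(w, X)` attached to `σ` and four indices `a, c, k, m` -/

section SpecialPoint

/-- The corank-one matrix `w_{σ,k,m} = Σ_{j ≠ m} E_{j,σ(j)} + E_{k,σ(m)} + E_{m,σ(k)} + E_{m,σ(m)}`,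
written as `T_{mk} · Λ_m · T_{km} · P_σ` (two transvections, the normal form `Λ_m = diag(1,…,0_m,…,1)`
and the permutation matrix of `σ`): the point at which our proof of LMR Lemma 3.4.1 evaluates the
first-order identity. [cite: LandsbergManivelRessayre2013, Lemma 3.4.1 (p. 479)] -/
def fourTermW (σ : Equiv.Perm (Fin n)) (k m : Fin n) : Matrix (Fin n) (Fin n) ℂ :=
  transvection m k 1 * lamMatrix ℂ m * (transvection k m 1 * σ.permMatrix ℂ)

/-- The kernel vector `X_{σ,a,c} = E_{a,σ(c)} + E_{c,σ(a)}` of the Hessian of `det_n` at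
`w_{σ,k,m}`, written as `T_{mk} · (E_{ac} + E_{ca}) · T_{km} · P_σ`.
[cite: LandsbergManivelRessayre2013, Lemma 3.4.1 (p. 479)] -/
def fourTermX (σ : Equiv.Perm (Fin n)) (a c k m : Fin n) : Matrix (Fin n) (Fin n) ℂ :=
  transvection m k 1 * (Matrix.single a c (1 : ℂ) + Matrix.single c a 1) *
    (transvection k m 1 * σ.permMatrix ℂ)

/-- Entries of a permutation matrix. [folklore] -/
private theorem permMatrix_apply' (σ : Equiv.Perm (Fin n)) (i j : Fin n) :
    (σ.permMatrix ℂ : Matrix (Fin n) (Fin n) ℂ) i j = if σ i = j then 1 else 0 := by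
  rw [Equiv.Perm.permMatrix, PEquiv.toMatrix_apply, Equiv.toPEquiv_apply]
  simp only [Option.mem_def, Option.some.injEq]

/-- Two exclusive indicators add up to the indicator of the disjunction. [folklore] -/
private theorem ite_add_ite_of_not_and {p q : Prop} [Decidable p] [Decidable q] (h : ¬(p ∧ q)) :
    ((if p then 1 else 0 : ℂ) + if q then 1 else 0) = if p ∨ q then 1 else 0 := by
  by_cases hp : p <;> by_cases hq : q <;> simp_all

/-- Entries of `T_{km} · P_σ`: row `k` is `e_{σ(k)} + e_{σ(m)}`, row `i ≠ k` is `e_{σ(i)}`. [folklore] -/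
private theorem transvection_mul_permMatrix_apply (σ : Equiv.Perm (Fin n)) {k m : Fin n}
    (hkm : k ≠ m) (i j : Fin n) :
    (transvection k m (1 : ℂ) * σ.permMatrix ℂ) i j =
      if i = k then (if σ k = j ∨ σ m = j then 1 else 0) else (if σ i = j then 1 else 0) := by
  by_cases hi : i = k
  · subst hi
    rw [if_pos rfl, transvection_mul_apply_same, permMatrix_apply', permMatrix_apply', one_mul,
      ite_add_ite_of_not_and]
    rintro ⟨h1, h2⟩
    exact hkm (σ.injective (h1.trans h2.symm))
  · rw [if_neg hi, transvection_mul_apply_of_ne _ _ _ _ hi, permMatrix_apply']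

/-- **Entries of `w_{σ,k,m}`**: rows `k` and `m` equal `e_{σ(k)} + e_{σ(m)}`, every other row `i` is
`e_{σ(i)}`. [cite: LandsbergManivelRessayre2013, Lemma 3.4.1 (p. 479)] -/
theorem fourTermW_apply (σ : Equiv.Perm (Fin n)) {k m : Fin n} (hkm : k ≠ m) (i j : Fin n) :
    fourTermW σ k m i j =
      if i = k ∨ i = m then (if σ k = j ∨ σ m = j then 1 else 0) else (if σ i = j then 1 else 0) := by
  rw [fourTermW, Matrix.mul_assoc]
  set N := transvection k m (1 : ℂ) * σ.permMatrix ℂ with hN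
  have hΛN : ∀ i j, (lamMatrix ℂ m * N) i j = if i = m then 0 else N i j := by
    intro i j
    rw [lamMatrix, Matrix.diagonal_mul]
    split_ifs <;> simp
  by_cases him : i = m
  · subst him
    rw [transvection_mul_apply_same, hΛN, hΛN, if_pos rfl, if_neg hkm, zero_add, one_mul, hN,
      transvection_mul_permMatrix_apply σ hkm, if_pos rfl, if_pos (Or.inr rfl)]
  · rw [transvection_mul_apply_of_ne _ _ _ _ him, hΛN, if_neg him, hN,
      transvection_mul_permMatrix_apply σ hkm]
    by_cases hik : i = k
    · rw [if_pos hik, if_pos (Or.inl hik)]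
    · rw [if_neg hik, if_neg (not_or.mpr ⟨hik, him⟩)]

/-- **Entries of `X_{σ,a,c}`**: `X = E_{a,σ(c)} + E_{c,σ(a)}` (for `a, c, k, m` pairwise distinct).
[cite: LandsbergManivelRessayre2013, Lemma 3.4.1 (p. 479)] -/
theorem fourTermX_apply (σ : Equiv.Perm (Fin n)) {a c k m : Fin n} (hac : a ≠ c) (hak : a ≠ k)
    (ham : a ≠ m) (hck : c ≠ k) (hcm : c ≠ m) (hkm : k ≠ m) (i j : Fin n) :
    fourTermX σ a c k m i j = if (i = a ∧ σ c = j) ∨ (i = c ∧ σ a = j) then 1 else 0 := by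
  classical
  rw [fourTermX, Matrix.mul_assoc]
  set N := transvection k m (1 : ℂ) * σ.permMatrix ℂ with hN
  have hNa : ∀ j, N a j = if σ a = j then 1 else 0 := fun j => by
    rw [hN, transvection_mul_permMatrix_apply σ hkm, if_neg hak]
  have hNc : ∀ j, N c j = if σ c = j then 1 else 0 := fun j => by
    rw [hN, transvection_mul_permMatrix_apply σ hkm, if_neg hck]
  -- `(E_{ac} + E_{ca}) · N`
  have hsingle : ∀ (p q : Fin n) (i j : Fin n),
      (Matrix.single p q (1 : ℂ) * N) i j = if i = p then N q j else 0 := by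
    intro p q i j
    simp only [Matrix.mul_apply, Matrix.single_apply, ite_mul, one_mul, zero_mul]
    by_cases hi : i = p
    · simp only [hi, true_and, Finset.sum_ite_eq, Finset.mem_univ, if_true]
    · rw [if_neg hi]
      refine Finset.sum_eq_zero fun x _ => ?_
      rw [if_neg (fun h => hi h.1.symm)]
  have hY : ∀ i j, ((Matrix.single a c (1 : ℂ) + Matrix.single c a (1 : ℂ)) * N) i j =
      if (i = a ∧ σ c = j) ∨ (i = c ∧ σ a = j) then 1 else 0 := by
    intro i j
    rw [Matrix.add_mul, Matrix.add_apply, hsingle, hsingle]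
    by_cases hia : i = a
    · have hic : i ≠ c := fun h => hac (hia.symm.trans h)
      rw [if_pos hia, if_neg hic, add_zero, hNc]
      by_cases h : σ c = j <;> simp [h, hia, hac]
    · rw [if_neg hia, zero_add]
      by_cases hic : i = c
      · rw [if_pos hic, hNa]
        by_cases h : σ a = j <;> simp [h, hic, Ne.symm hac]
      · rw [if_neg hic, if_neg (by tauto)]
  by_cases him : i = m
  · subst him
    have hka : k ≠ a := fun h => hak h.symm
    have hkc : k ≠ c := fun h => hck h.symm
    rw [transvection_mul_apply_same, hY, hY, one_mul]
    simp [Ne.symm ham, Ne.symm hcm, hka, hkc]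
  · rw [transvection_mul_apply_of_ne _ _ _ _ him, hY]

end SpecialPoint

/-! ### Rank and kernel at the special point -/

section RankKernel

variable (σ : Equiv.Perm (Fin n)) {a c k m : Fin n}

/-- `det(T_{km} · P_σ)` is a unit. [folklore] -/
private theorem isUnit_det_transvection_mul_permMatrix (hkm : k ≠ m) :
    IsUnit (transvection k m (1 : ℂ) * σ.permMatrix ℂ).det := by
  rw [det_mul, det_transvection_of_ne _ _ hkm, one_mul, det_permutation]
  rcases Int.units_eq_one_or (Equiv.Perm.sign σ) with h | h <;> simp [h]

/-- **`w_{σ,k,m}` has rank `n − 1`** (it is `T Λ_m T′ P_σ` with `T, T′, P_σ` invertible).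
[cite: LandsbergManivelRessayre2013, Lemma 3.4.1 (p. 479)] -/
theorem rank_fourTermW (hkm : k ≠ m) : (fourTermW σ k m).rank = n - 1 := by
  have hT : IsUnit (transvection m k (1 : ℂ)).det := by
    rw [det_transvection_of_ne _ _ hkm.symm]; exact isUnit_one
  rw [fourTermW, Matrix.rank_mul_eq_left_of_isUnit_det _ _
      (isUnit_det_transvection_mul_permMatrix σ hkm),
    Matrix.rank_mul_eq_right_of_isUnit_det _ _ hT, rank_lamMatrix, Fintype.card_fin]

/-- **`X_{σ,a,c}` lies in the kernel (radical) of the Hessian of `det_n` at `w_{σ,k,m}`** — by the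
transport `X ↦ T X T′P_σ` of the radical (`hessianMatrix_detPoly_mulVec_eq_zero_iff_of_mul_mul`,
val-lit-t10) it suffices that `E_{ac} + E_{ca}` has zero `m`-th row and column and zero diagonal sum
(LMR Lemma 3.3.1 at `Λ_m`, `hessianMatrix_detPoly_lamMatrix_mulVec_eq_zero_iff`).
[cite: LandsbergManivelRessayre2013, Lemma 3.3.1 (p. 478)] -/
theorem hessianMatrix_detPoly_fourTermW_mulVec_fourTermX (hn : 2 ≤ n) (hac : a ≠ c) (ham : a ≠ m)
    (hcm : c ≠ m) (hkm : k ≠ m) :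
    hessianMatrix (detPoly (Fin n) ℂ) (fun p => fourTermW σ k m p.1 p.2) *ᵥ
      (fun p => fourTermX σ a c k m p.1 p.2) = 0 := by
  have hP : IsUnit (transvection m k (1 : ℂ)) := (Matrix.isUnit_iff_isUnit_det _).mpr
    (by rw [det_transvection_of_ne _ _ hkm.symm]; exact isUnit_one)
  have hQ : IsUnit (transvection k m (1 : ℂ) * σ.permMatrix ℂ) :=
    (Matrix.isUnit_iff_isUnit_det _).mpr (isUnit_det_transvection_mul_permMatrix σ hkm)
  rw [fourTermW, fourTermX, hessianMatrix_detPoly_mulVec_eq_zero_iff_of_mul_mul hP hQ,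
    hessianMatrix_detPoly_lamMatrix_mulVec_eq_zero_iff m (by rw [Fintype.card_fin]; exact hn)]
  refine ⟨fun j => ?_, fun j => ?_, Finset.sum_eq_zero fun j _ => ?_⟩
  · simp [Matrix.add_apply, ham, hcm]
  · simp [Matrix.add_apply, ham, hcm]
  · simp only [Matrix.add_apply, Matrix.single_apply]
    rw [if_neg (fun h => hac (h.1.trans h.2.symm)), if_neg (fun h => hac (h.2.trans h.1.symm)),
      add_zero]

end RankKernel

/-! ### Evaluation engine: products of the `0/1` entries of `w_{σ,k,m}` along a permutation -/

section Engine

variable (σ : Equiv.Perm (Fin n)) {a c k m : Fin n}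

/-- The entry `w_{i,ρ(i)}` is the indicator of: `ρ(i) ∈ {σ(k), σ(m)}` if `i ∈ {k, m}`, and
`ρ(i) = σ(i)` otherwise. [cite: LandsbergManivelRessayre2013, Lemma 3.4.1 (p. 479)] -/
theorem fourTermW_apply_perm (hkm : k ≠ m) (ρ : Equiv.Perm (Fin n)) (i : Fin n) :
    fourTermW σ k m i (ρ i) =
      if ((i = k ∨ i = m) → (σ k = ρ i ∨ σ m = ρ i)) ∧ (¬(i = k ∨ i = m) → σ i = ρ i)
      then 1 else 0 := by
  rw [fourTermW_apply σ hkm]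
  by_cases h : i = k ∨ i = m
  · simp only [h, if_true, not_true_eq_false, false_imp_iff, and_true, forall_true_left]
  · simp only [h, if_false, false_imp_iff, true_and, not_false_eq_true, forall_true_left]

/-- Products of entries of `w_{σ,k,m}` along a permutation are indicators.
[cite: LandsbergManivelRessayre2013, Lemma 3.4.1 (p. 479)] -/
theorem prod_fourTermW_apply_perm (hkm : k ≠ m) (ρ : Equiv.Perm (Fin n)) (S : Finset (Fin n)) :
    ∏ i ∈ S, fourTermW σ k m i (ρ i) =
      if ∀ i ∈ S, ((i = k ∨ i = m) → (σ k = ρ i ∨ σ m = ρ i)) ∧ (¬(i = k ∨ i = m) → σ i = ρ i)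
      then 1 else 0 := by
  simp_rw [fourTermW_apply_perm σ hkm]
  rw [Finset.prod_boole]
  split_ifs <;> rfl

/-- **The permutations compatible with the pattern of `w_{σ,k,m}` on all rows are `σ` and
`σ·(k m)`.** [cite: LandsbergManivelRessayre2013, Lemma 3.4.1 (p. 479)] -/
theorem forall_compat_iff (hkm : k ≠ m) (ρ : Equiv.Perm (Fin n)) :
    (∀ i, ((i = k ∨ i = m) → (σ k = ρ i ∨ σ m = ρ i)) ∧ (¬(i = k ∨ i = m) → σ i = ρ i)) ↔
      ρ = σ ∨ ρ = σ * Equiv.swap k m := by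
  constructor
  · intro h
    have hk := (h k).1 (Or.inl rfl)
    have hm := (h m).1 (Or.inr rfl)
    have hoff : ∀ i, i ≠ k → i ≠ m → σ i = ρ i := fun i hik him => (h i).2 (not_or.mpr ⟨hik, him⟩)
    rcases hk with hk | hk
    · -- `ρ k = σ k`, hence `ρ m = σ m` and `ρ = σ`
      left
      have hm' : σ m = ρ m := by
        rcases hm with hm | hm
        · exact absurd (ρ.injective (hm.symm.trans hk)) hkm.symm
        · exact hm
      ext i
      by_cases hik : i = k
      · rw [hik, hk]
      by_cases him : i = m
      · rw [him, hm']
      · rw [hoff i hik him]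
    · -- `ρ k = σ m`, hence `ρ m = σ k` and `ρ = σ (k m)`
      right
      have hm' : σ k = ρ m := by
        rcases hm with hm | hm
        · exact hm
        · exact absurd (ρ.injective (hm.symm.trans hk)) hkm.symm
      ext i
      rw [Equiv.Perm.mul_apply]
      by_cases hik : i = k
      · rw [hik, Equiv.swap_apply_left, hk]
      by_cases him : i = m
      · rw [him, Equiv.swap_apply_right, hm']
      · rw [Equiv.swap_apply_of_ne_of_ne hik him, hoff i hik him]
  · rintro (rfl | rfl) i
    · exact ⟨fun h => h.elim (fun h => Or.inl (by rw [h])) (fun h => Or.inr (by rw [h])),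
        fun _ => rfl⟩
    · refine ⟨fun h => h.elim (fun h => Or.inr ?_) (fun h => Or.inl ?_), fun h => ?_⟩
      · rw [h, Equiv.Perm.mul_apply, Equiv.swap_apply_left]
      · rw [h, Equiv.Perm.mul_apply, Equiv.swap_apply_right]
      · obtain ⟨hik, him⟩ := not_or.mp h
        rw [Equiv.Perm.mul_apply, Equiv.swap_apply_of_ne_of_ne hik him]

/-- `τ ≠ τ·(k m)`. [folklore] -/
private theorem ne_mul_swap (τ : Equiv.Perm (Fin n)) (hkm : k ≠ m) : τ ≠ τ * Equiv.swap k m := by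
  intro h
  have := congrArg (· k) h
  simp only [Equiv.Perm.mul_apply, Equiv.swap_apply_left] at this
  exact hkm (τ.injective this)

/-- A finite sum supported on two points. [folklore] -/
private theorem sum_ite_eq_or {α : Type*} [Fintype α] [DecidableEq α] {τ₁ τ₂ : α} (hne : τ₁ ≠ τ₂)
    (f : α → ℂ) :
    (∑ ρ : α, if ρ = τ₁ ∨ ρ = τ₂ then f ρ else 0) = f τ₁ + f τ₂ := by
  have hsplit : ∀ ρ : α, (if ρ = τ₁ ∨ ρ = τ₂ then f ρ else 0) =
      (if ρ = τ₁ then f ρ else 0) + (if ρ = τ₂ then f ρ else 0) := by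
    intro ρ
    by_cases h1 : ρ = τ₁
    · rw [if_pos (Or.inl h1), if_pos h1, if_neg (fun h2 => hne (h1.symm.trans h2)), add_zero]
    · by_cases h2 : ρ = τ₂
      · rw [if_pos (Or.inr h2), if_neg h1, if_pos h2, zero_add]
      · rw [if_neg (not_or.mpr ⟨h1, h2⟩), if_neg h1, if_neg h2, add_zero]
  simp_rw [hsplit]
  rw [Finset.sum_add_distrib, Finset.sum_ite_eq' Finset.univ τ₁, Finset.sum_ite_eq' Finset.univ,
    if_pos (Finset.mem_univ _), if_pos (Finset.mem_univ _)]

/-- Summing over the two compatible permutations. [cite: LandsbergManivelRessayre2013, Lemma 3.4.1 (p. 479)] -/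
theorem sum_ite_forall_compat (hkm : k ≠ m) (f : Equiv.Perm (Fin n) → ℂ) :
    (∑ ρ : Equiv.Perm (Fin n),
      if ∀ i, ((i = k ∨ i = m) → (σ k = ρ i ∨ σ m = ρ i)) ∧ (¬(i = k ∨ i = m) → σ i = ρ i)
      then f ρ else 0) = f σ + f (σ * Equiv.swap k m) := by
  classical
  simp_rw [forall_compat_iff σ hkm]
  exact sum_ite_eq_or (ne_mul_swap σ hkm) f

/-- Disjoint transpositions commute. [folklore] -/
private theorem swap_mul_swap_comm (hak : a ≠ k) (ham : a ≠ m) (hck : c ≠ k) (hcm : c ≠ m) :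
    Equiv.swap a c * Equiv.swap k m = Equiv.swap k m * Equiv.swap a c := by
  have hdisj : Equiv.Perm.Disjoint (Equiv.swap a c) (Equiv.swap k m) := fun x => by
    by_cases hxa : x = a
    · subst hxa; exact Or.inr (Equiv.swap_apply_of_ne_of_ne hak ham)
    by_cases hxc : x = c
    · subst hxc; exact Or.inr (Equiv.swap_apply_of_ne_of_ne hck hcm)
    · exact Or.inl (Equiv.swap_apply_of_ne_of_ne hxa hxc)
  exact hdisj.commute.eq

/-- The pattern condition for `ρ·(a c)` is the "swapped" condition for `ρ` (with `a, c ∉ {k, m}`).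
[cite: LandsbergManivelRessayre2013, Lemma 3.4.1 (p. 479)] -/
theorem forall_compat_mul_swap_iff (hak : a ≠ k) (ham : a ≠ m) (hck : c ≠ k)
    (hcm : c ≠ m) (ρ : Equiv.Perm (Fin n)) :
    (∀ i, ((i = k ∨ i = m) → (σ k = (ρ * Equiv.swap a c) i ∨ σ m = (ρ * Equiv.swap a c) i)) ∧
        (¬(i = k ∨ i = m) → σ i = (ρ * Equiv.swap a c) i)) ↔
      σ c = ρ a ∧ σ a = ρ c ∧ ∀ i ∈ (Finset.univ.erase a).erase c,
        ((i = k ∨ i = m) → (σ k = ρ i ∨ σ m = ρ i)) ∧ (¬(i = k ∨ i = m) → σ i = ρ i) := by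
  have hswap : ∀ i, i ≠ a → i ≠ c → (ρ * Equiv.swap a c) i = ρ i := fun i hia hic => by
    rw [Equiv.Perm.mul_apply, Equiv.swap_apply_of_ne_of_ne hia hic]
  have ha : (ρ * Equiv.swap a c) a = ρ c := by rw [Equiv.Perm.mul_apply, Equiv.swap_apply_left]
  have hc : (ρ * Equiv.swap a c) c = ρ a := by rw [Equiv.Perm.mul_apply, Equiv.swap_apply_right]
  have hna : ¬(a = k ∨ a = m) := not_or.mpr ⟨hak, ham⟩
  have hnc : ¬(c = k ∨ c = m) := not_or.mpr ⟨hck, hcm⟩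
  constructor
  · intro h
    refine ⟨?_, ?_, fun i hi => ?_⟩
    · have := (h c).2 hnc; rwa [hc] at this
    · have := (h a).2 hna; rwa [ha] at this
    · obtain ⟨hic, hia⟩ : i ≠ c ∧ i ≠ a := by
        simpa only [Finset.mem_erase, Finset.mem_univ, and_true] using hi
      have := h i; rwa [hswap i hia hic] at this
  · rintro ⟨h1, h2, h⟩ i
    by_cases hia : i = a
    · subst hia; rw [ha]; exact ⟨fun h' => absurd h' hna, fun _ => h2⟩
    by_cases hic : i = c
    · subst hic; rw [hc]; exact ⟨fun h' => absurd h' hnc, fun _ => h1⟩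
    · rw [hswap i hia hic]
      exact h i (by simp [Finset.mem_erase, hia, hic])

/-- **The permutations with `ρ(a) = σ(c)`, `ρ(c) = σ(a)` compatible with the pattern of `w_{σ,k,m}`
off the rows `a, c` are `σ·(a c)` and `σ·(a c)·(k m)`.** [cite: LandsbergManivelRessayre2013, Lemma 3.4.1 (p. 479)] -/
theorem swapped_compat_iff (hak : a ≠ k) (ham : a ≠ m) (hck : c ≠ k) (hcm : c ≠ m) (hkm : k ≠ m)
    (ρ : Equiv.Perm (Fin n)) :
    (σ c = ρ a ∧ σ a = ρ c ∧ ∀ i ∈ (Finset.univ.erase a).erase c,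
        ((i = k ∨ i = m) → (σ k = ρ i ∨ σ m = ρ i)) ∧ (¬(i = k ∨ i = m) → σ i = ρ i)) ↔
      ρ = σ * Equiv.swap a c ∨ ρ = σ * Equiv.swap a c * Equiv.swap k m := by
  rw [← forall_compat_mul_swap_iff σ hak ham hck hcm ρ, forall_compat_iff σ hkm]
  have e : ∀ τ : Equiv.Perm (Fin n), ρ * Equiv.swap a c = τ ↔ ρ = τ * Equiv.swap a c := by
    intro τ
    constructor
    · intro h; rw [← h, mul_assoc, Equiv.swap_mul_self, mul_one]
    · intro h; rw [h, mul_assoc, Equiv.swap_mul_self, mul_one]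
  rw [e, e, mul_assoc σ (Equiv.swap k m), ← swap_mul_swap_comm hak ham hck hcm, ← mul_assoc]

end Engine

/-! ### The immanant and its Hessian form at the special point -/

section ImmanantEval

variable (σ : Equiv.Perm (Fin n)) {a c k m : Fin n}

/-- **`IM_λ(w_{σ,k,m}) = χ_λ(σ) + χ_λ(σ·(k m))`.** [cite: LandsbergManivelRessayre2013, Lemma 3.4.1 (p. 479)] -/
theorem eval_fourTermW_immanant (hkm : k ≠ m) (lam : Nat.Partition n) :
    eval (fun p : Fin n × Fin n => fourTermW σ k m p.1 p.2) (immanant lam) =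
      spechtCharacter ℂ lam σ + spechtCharacter ℂ lam (σ * Equiv.swap k m) := by
  classical
  rw [immanant, map_sum]
  simp_rw [smul_eval, map_prod, eval_X]
  simp_rw [prod_fourTermW_apply_perm σ hkm, mul_boole]
  simp only [Finset.mem_univ, forall_true_left]
  exact sum_ite_forall_compat σ hkm _

/-- **`Xᵀ·Hess IM_λ(w_{σ,k,m})·X = 2·(χ_λ(σ·(a c)) + χ_λ(σ·(a c)(k m)))`** for `X = X_{σ,a,c}`: in
`Σ_ρ χ_λ(ρ) Σ_{a′≠c′} X_{a′ρ(a′)}X_{c′ρ(c′)} ∏_{i≠a′,c′} w_{iρ(i)}` only `{a′,c′} = {a,c}` and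
`ρ ∈ σ·(a c)·{1, (k m)}` survive. [cite: LandsbergManivelRessayre2013, Lemma 3.4.1 (p. 479)] -/
theorem dotProduct_hessianMatrix_immanant_fourTerm (hac : a ≠ c) (hak : a ≠ k) (ham : a ≠ m)
    (hck : c ≠ k) (hcm : c ≠ m) (hkm : k ≠ m) (lam : Nat.Partition n) :
    (fun p : Fin n × Fin n => fourTermX σ a c k m p.1 p.2) ⬝ᵥ
        (hessianMatrix (immanant lam) (fun p => fourTermW σ k m p.1 p.2) *ᵥ
          fun p => fourTermX σ a c k m p.1 p.2) =
      2 * (spechtCharacter ℂ lam (σ * Equiv.swap a c) +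
        spechtCharacter ℂ lam (σ * Equiv.swap a c * Equiv.swap k m)) := by
  classical
  rw [dotProduct_hessianMatrix_immanant_mulVec]
  have hX : ∀ i j, fourTermX σ a c k m i j = if (i = a ∧ σ c = j) ∨ (i = c ∧ σ a = j) then 1 else 0 :=
    fourTermX_apply σ hac hak ham hck hcm hkm
  -- the inner double sum, permutation by permutation
  have hinner : ∀ ρ : Equiv.Perm (Fin n),
      (∑ a', ∑ c' ∈ Finset.univ.erase a', fourTermX σ a c k m a' (ρ a') *
        fourTermX σ a c k m c' (ρ c') * ∏ i ∈ (Finset.univ.erase a').erase c',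
          fourTermW σ k m i (ρ i)) =
      2 * if (σ c = ρ a ∧ σ a = ρ c ∧ ∀ i ∈ (Finset.univ.erase a).erase c,
          ((i = k ∨ i = m) → (σ k = ρ i ∨ σ m = ρ i)) ∧ (¬(i = k ∨ i = m) → σ i = ρ i))
        then 1 else 0 := by
    intro ρ
    have hzero : ∀ a', a' ≠ a → a' ≠ c → fourTermX σ a c k m a' (ρ a') = 0 := by
      intro a' h1 h2
      rw [hX, if_neg (by tauto)]
    have hXa : fourTermX σ a c k m a (ρ a) = if σ c = ρ a then 1 else 0 := by
      rw [hX]; by_cases h : σ c = ρ a <;> simp [h, hac]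
    have hXc : fourTermX σ a c k m c (ρ c) = if σ a = ρ c then 1 else 0 := by
      rw [hX]; by_cases h : σ a = ρ c <;> simp [h, Ne.symm hac]
    rw [Finset.sum_eq_add_of_mem a c (Finset.mem_univ _) (Finset.mem_univ _) hac
      (fun a' _ ha' => Finset.sum_eq_zero fun c' _ => by
        rw [hzero a' ha'.1 ha'.2, zero_mul, zero_mul]),
      Finset.sum_eq_single_of_mem c (Finset.mem_erase.mpr ⟨hac.symm, Finset.mem_univ _⟩)
        (fun c' hc' hc'c => by
          rw [hzero c' (Finset.mem_erase.mp hc').1 hc'c, mul_zero, zero_mul]),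
      Finset.sum_eq_single_of_mem a (Finset.mem_erase.mpr ⟨hac, Finset.mem_univ _⟩)
        (fun a' ha' ha'a => by
          rw [hzero a' ha'a (Finset.mem_erase.mp ha').1, mul_zero, zero_mul]),
      hXa, hXc, Finset.erase_right_comm (a := c), prod_fourTermW_apply_perm σ hkm]
    simp only [boole_mul, ite_and]
    by_cases h1 : σ c = ρ a <;> by_cases h2 : σ a = ρ c <;> simp [h1, h2]
    all_goals (try (split_ifs <;> norm_num))
  simp_rw [hinner, swapped_compat_iff σ hak ham hck hcm hkm]
  have hne : σ * Equiv.swap a c ≠ σ * Equiv.swap a c * Equiv.swap k m :=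
    ne_mul_swap (σ * Equiv.swap a c) hkm
  simp_rw [mul_ite, mul_one, mul_zero]
  have key := sum_ite_eq_or hne (fun ρ => spechtCharacter ℂ lam ρ * 2)
  beta_reduce at key
  rw [key]
  ring

end ImmanantEval

/-! ### The orbit tangent vector `π₁ = x_{kσ(k)} · ∂_{(m,σ(m))} det_n` at the special point -/

section OrbitVector

variable (σ : Equiv.Perm (Fin n)) {a c k m : Fin n}

/-- `∂_{(m,σ(m))} det_n = Σ_ρ sgn ρ · [ρ(m) = σ(m)] · ∏_{i ≠ m} x_{iρ(i)}` (cofactor expansion, row-indexed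
Leibniz). [cite: LandsbergManivelRessayre2013, §3.4 (p. 479)] -/
theorem pderiv_detPoly_eq_sum (m b : Fin n) :
    pderiv (m, b) (detPoly (Fin n) ℂ) = ∑ ρ : Equiv.Perm (Fin n),
      C (((Equiv.Perm.sign ρ : ℤ) : ℂ)) *
        (if ρ m = b then ∏ i ∈ Finset.univ.erase m, (X (i, ρ i) : MvPolynomial (Fin n × Fin n) ℂ)
          else 0) := by
  rw [detPoly_eq_sum_sign_smul_prod, map_sum]
  refine Finset.sum_congr rfl fun ρ _ => ?_
  rw [MvPolynomial.smul_eq_C_mul, pderiv_C_mul, pderiv_prod_X_perm_row]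
  simp only [Finset.mem_univ, true_and]

/-- **`(∂_{(m,σ(m))} det_n)(w_{σ,k,m}) = sgn σ`**: only `ρ = σ` is compatible with the pattern of
`w` off the row `m` together with `ρ(m) = σ(m)`. [cite: LandsbergManivelRessayre2013, Lemma 3.4.1 (p. 479)] -/
theorem eval_fourTermW_pderiv_detPoly (hkm : k ≠ m) :
    eval (fun p : Fin n × Fin n => fourTermW σ k m p.1 p.2) (pderiv (m, σ m) (detPoly (Fin n) ℂ)) =
      ((Equiv.Perm.sign σ : ℤ) : ℂ) := by
  classical
  rw [pderiv_detPoly_eq_sum, map_sum]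
  have hterm : ∀ ρ : Equiv.Perm (Fin n),
      eval (fun p : Fin n × Fin n => fourTermW σ k m p.1 p.2) (C (((Equiv.Perm.sign ρ : ℤ) : ℂ)) *
        (if ρ m = σ m then ∏ i ∈ Finset.univ.erase m, (X (i, ρ i) : MvPolynomial (Fin n × Fin n) ℂ)
          else 0)) =
      if ρ = σ then ((Equiv.Perm.sign ρ : ℤ) : ℂ) else 0 := by
    intro ρ
    rw [map_mul, eval_C]
    by_cases hρm : ρ m = σ m
    · rw [if_pos hρm, map_prod]
      simp_rw [eval_X]
      rw [prod_fourTermW_apply_perm σ hkm, mul_boole]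
      congr 1
      refine propext ⟨fun h => ?_, fun h => fun i _ => ?_⟩
      · have hall : ∀ i, ((i = k ∨ i = m) → (σ k = ρ i ∨ σ m = ρ i)) ∧
            (¬(i = k ∨ i = m) → σ i = ρ i) := by
          intro i
          by_cases him : i = m
          · subst him; exact ⟨fun _ => Or.inr hρm.symm, fun h' => absurd (Or.inr rfl) h'⟩
          · exact h i (Finset.mem_erase.mpr ⟨him, Finset.mem_univ _⟩)
        rcases (forall_compat_iff σ hkm ρ).mp hall with h' | h'
        · exact h'
        · exfalso
          rw [h', Equiv.Perm.mul_apply, Equiv.swap_apply_right] at hρm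
          exact hkm (σ.injective hρm)
      · rw [h]
        exact ((forall_compat_iff σ hkm σ).mpr (Or.inl rfl)) i
    · rw [if_neg hρm, map_zero, mul_zero, if_neg]
      rintro rfl
      exact hρm rfl
  simp_rw [hterm]
  rw [Finset.sum_ite_eq' Finset.univ σ, if_pos (Finset.mem_univ _)]

/-- `w_{σ,k,m}` has entry `1` at `(k, σ(k))`. [cite: LandsbergManivelRessayre2013, Lemma 3.4.1 (p. 479)] -/
theorem fourTermW_apply_k (hkm : k ≠ m) : fourTermW σ k m k (σ k) = 1 := by
  rw [fourTermW_apply σ hkm, if_pos (Or.inl rfl), if_pos (Or.inl rfl)]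

/-- **`π₁(w_{σ,k,m}) = sgn σ`** for the orbit tangent vector `π₁ = x_{kσ(k)} · ∂_{(m,σ(m))} det_n`.
[cite: LandsbergManivelRessayre2013, Lemma 3.4.1 (p. 479)] -/
theorem eval_fourTermW_orbitVector (hkm : k ≠ m) :
    eval (fun p : Fin n × Fin n => fourTermW σ k m p.1 p.2)
        (X (k, σ k) * pderiv (m, σ m) (detPoly (Fin n) ℂ)) = ((Equiv.Perm.sign σ : ℤ) : ℂ) := by
  rw [map_mul, eval_X, eval_fourTermW_pderiv_detPoly σ hkm]
  simp only [fourTermW_apply_k σ hkm, one_mul]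

/-- **The Hessian form of `x_{u₀} · D` against a vector `X` with `X_{u₀} = 0`** is
`w_{u₀} · (Xᵀ·Hess D(w)·X)` (product rule; the cross terms carry `X_{u₀}`).
[cite: LandsbergManivelRessayre2013, §3.3 (p. 477)] -/
theorem dotProduct_hessianMatrix_X_mul_mulVec {ι : Type*} [Fintype ι] [DecidableEq ι]
    (u₀ : ι) (D : MvPolynomial ι ℂ) (w X : ι → ℂ) (hX : X u₀ = 0) :
    X ⬝ᵥ (hessianMatrix (MvPolynomial.X u₀ * D) w *ᵥ X) =
      w u₀ * (X ⬝ᵥ (hessianMatrix D w *ᵥ X)) := by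
  have hentry : ∀ u v, hessianMatrix (MvPolynomial.X u₀ * D) w u v =
      w u₀ * hessianMatrix D w u v + (if u₀ = u then eval w (pderiv v D) else 0) +
        (if u₀ = v then eval w (pderiv u D) else 0) := by
    intro u v
    rw [hessianMatrix_apply, hessianMatrix_apply, Derivation.leibniz, smul_eq_mul, smul_eq_mul,
      pderiv_X, map_add, Derivation.leibniz, Derivation.leibniz, smul_eq_mul, smul_eq_mul, smul_eq_mul,
      smul_eq_mul, pderiv_X]
    have h0 : pderiv u (Pi.single (M := fun _ => MvPolynomial ι ℂ) v 1 u₀) = 0 := by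
      by_cases h : u₀ = v
      · subst h; rw [Pi.single_eq_same]; exact Derivation.map_one_eq_zero _
      · rw [Pi.single_eq_of_ne h, map_zero]
    rw [h0, mul_zero, zero_add, map_add, map_add, map_mul, map_mul, map_mul, eval_X]
    simp only [Pi.single_apply, apply_ite (eval w), map_one, map_zero]
    split_ifs <;> ring
  simp only [dotProduct, Matrix.mulVec, hentry, mul_add, add_mul, Finset.sum_add_distrib,
    Finset.mul_sum]
  have h1 : ∑ u, ∑ v, X u * ((if u₀ = u then eval w (pderiv v D) else 0) * X v) = 0 := by
    rw [Finset.sum_eq_single u₀]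
    · rw [hX]; simp
    · intro u _ hu
      exact Finset.sum_eq_zero fun v _ => by rw [if_neg (Ne.symm hu), zero_mul, mul_zero]
    · intro h; exact absurd (Finset.mem_univ _) h
  have h2 : ∑ u, ∑ v, X u * ((if u₀ = v then eval w (pderiv u D) else 0) * X v) = 0 := by
    refine Finset.sum_eq_zero fun u _ => ?_
    rw [Finset.sum_eq_single u₀]
    · rw [hX]; simp
    · intro v _ hv; rw [if_neg (Ne.symm hv), zero_mul, mul_zero]
    · intro h; exact absurd (Finset.mem_univ _) h
  rw [h1, h2, add_zero, add_zero]
  refine Finset.sum_congr rfl fun u _ => Finset.sum_congr rfl fun v _ => ?_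
  ring

/-- Entries of the Hessian of `∂_{(m,b)} det_n`: third partial derivatives of the determinant as a
permutation sum. [cite: LandsbergManivelRessayre2013, §3.4 (p. 479)] -/
theorem hessianMatrix_pderiv_detPoly_apply (m b : Fin n) (w : Fin n × Fin n → ℂ)
    (u v : Fin n × Fin n) :
    hessianMatrix (pderiv (m, b) (detPoly (Fin n) ℂ)) w u v = ∑ ρ : Equiv.Perm (Fin n),
      ((Equiv.Perm.sign ρ : ℤ) : ℂ) *
        (if ρ m = b ∧ (v.1 ∈ Finset.univ.erase m ∧ ρ v.1 = v.2) ∧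
            (u.1 ∈ (Finset.univ.erase m).erase v.1 ∧ ρ u.1 = u.2) then
          ∏ i ∈ ((Finset.univ.erase m).erase v.1).erase u.1, w (i, ρ i) else 0) := by
  classical
  rw [hessianMatrix_apply, pderiv_detPoly_eq_sum, map_sum, map_sum, map_sum]
  refine Finset.sum_congr rfl fun ρ _ => ?_
  rw [pderiv_C_mul, pderiv_C_mul, map_mul, eval_C]
  congr 1
  by_cases h1 : ρ m = b
  · rw [if_pos h1]
    obtain ⟨v1, v2⟩ := v
    obtain ⟨u1, u2⟩ := u
    rw [pderiv_prod_X_perm_row]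
    by_cases h2 : v1 ∈ Finset.univ.erase m ∧ ρ v1 = v2
    · rw [if_pos h2, pderiv_prod_X_perm_row]
      by_cases h3 : u1 ∈ (Finset.univ.erase m).erase v1 ∧ ρ u1 = u2
      · rw [if_pos h3, if_pos ⟨h1, h2, h3⟩, map_prod]
        simp_rw [eval_X]
      · rw [if_neg h3, map_zero, if_neg (fun h => h3 h.2.2)]
    · rw [if_neg h2, map_zero, map_zero, if_neg (fun h => h2 h.2.1)]
  · rw [if_neg h1, map_zero, map_zero, map_zero, if_neg (fun h => h1 h.1)]

/-- The condition singling out `ρ = σ·(a c)`: `ρ(m) = σ(m)`, `ρ(c) = σ(a)`, `ρ(a) = σ(c)` and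
compatibility with the pattern of `w_{σ,k,m}` elsewhere. [cite: LandsbergManivelRessayre2013, Lemma 3.4.1 (p. 479)] -/
theorem swapped_compat_fixed_iff (hac : a ≠ c) (hak : a ≠ k) (ham : a ≠ m) (hck : c ≠ k)
    (hcm : c ≠ m) (hkm : k ≠ m) (ρ : Equiv.Perm (Fin n)) :
    (ρ m = σ m ∧ c ∈ Finset.univ.erase m ∧ ρ c = σ a ∧
        a ∈ (Finset.univ.erase m).erase c ∧ ρ a = σ c ∧
        ∀ i ∈ ((Finset.univ.erase m).erase c).erase a,
          ((i = k ∨ i = m) → (σ k = ρ i ∨ σ m = ρ i)) ∧ (¬(i = k ∨ i = m) → σ i = ρ i)) ↔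
      ρ = σ * Equiv.swap a c := by
  constructor
  · rintro ⟨hm, -, hc, -, ha, h⟩
    have h' : σ c = ρ a ∧ σ a = ρ c ∧ ∀ i ∈ (Finset.univ.erase a).erase c,
        ((i = k ∨ i = m) → (σ k = ρ i ∨ σ m = ρ i)) ∧ (¬(i = k ∨ i = m) → σ i = ρ i) := by
      refine ⟨ha.symm, hc.symm, fun i hi => ?_⟩
      by_cases him : i = m
      · subst him; exact ⟨fun _ => Or.inr hm.symm, fun h' => absurd (Or.inr rfl) h'⟩
      · obtain ⟨hic, hia, -⟩ : i ≠ c ∧ i ≠ a ∧ True := by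
          simpa only [Finset.mem_erase, Finset.mem_univ, and_true] using hi
        exact h i (by simp [Finset.mem_erase, him, hic, hia])
    rcases (swapped_compat_iff σ hak ham hck hcm hkm ρ).mp h' with h'' | h''
    · exact h''
    · exfalso
      rw [h'', Equiv.Perm.mul_apply, Equiv.Perm.mul_apply, Equiv.swap_apply_right,
        Equiv.swap_apply_of_ne_of_ne (Ne.symm hak) (Ne.symm hck)] at hm
      exact hkm (σ.injective hm)
  · intro h
    have h' := (swapped_compat_iff σ hak ham hck hcm hkm ρ).mpr (Or.inl h)
    refine ⟨?_, Finset.mem_erase.mpr ⟨hcm, Finset.mem_univ _⟩, h'.2.1.symm,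
      Finset.mem_erase.mpr ⟨hac, Finset.mem_erase.mpr ⟨ham, Finset.mem_univ _⟩⟩, h'.1.symm,
      fun i hi => h'.2.2 i ?_⟩
    · rw [h, Equiv.Perm.mul_apply, Equiv.swap_apply_of_ne_of_ne (Ne.symm ham) (Ne.symm hcm)]
    · simp only [Finset.mem_erase, Finset.mem_univ, and_true] at hi ⊢
      exact ⟨hi.2.1, hi.1⟩

/-- Diagonal entries of the Hessian of `∂_{(m,b)} det_n` vanish (each variable occurs at most once in
a monomial of the determinant). [cite: LandsbergManivelRessayre2013, §3.4 (p. 479)] -/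
theorem hessianMatrix_pderiv_detPoly_apply_self (m b : Fin n) (w : Fin n × Fin n → ℂ)
    (u : Fin n × Fin n) : hessianMatrix (pderiv (m, b) (detPoly (Fin n) ℂ)) w u u = 0 := by
  classical
  rw [hessianMatrix_pderiv_detPoly_apply]
  refine Finset.sum_eq_zero fun ρ _ => ?_
  rw [if_neg, mul_zero]
  rintro ⟨-, -, ⟨h, -⟩⟩
  exact (Finset.mem_erase.mp h).1 rfl

/-- **The mixed third derivative `∂_{(a,σc)} ∂_{(c,σa)} ∂_{(m,σm)} det_n` at `w_{σ,k,m}` is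
`sgn(σ·(a c)) = −sgn σ`**: only `ρ = σ·(a c)` contributes.
[cite: LandsbergManivelRessayre2013, Lemma 3.4.1 (p. 479)] -/
theorem hessianMatrix_pderiv_detPoly_fourTerm_offDiag (hac : a ≠ c) (hak : a ≠ k) (ham : a ≠ m)
    (hck : c ≠ k) (hcm : c ≠ m) (hkm : k ≠ m) :
    hessianMatrix (pderiv (m, σ m) (detPoly (Fin n) ℂ)) (fun p : Fin n × Fin n => fourTermW σ k m p.1 p.2)
        (a, σ c) (c, σ a) = -((Equiv.Perm.sign σ : ℤ) : ℂ) := by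
  classical
  rw [hessianMatrix_pderiv_detPoly_apply]
  have hterm : ∀ ρ : Equiv.Perm (Fin n),
      ((Equiv.Perm.sign ρ : ℤ) : ℂ) *
        (if ρ m = σ m ∧ ((c, σ a).1 ∈ Finset.univ.erase m ∧ ρ (c, σ a).1 = (c, σ a).2) ∧
            ((a, σ c).1 ∈ (Finset.univ.erase m).erase (c, σ a).1 ∧ ρ (a, σ c).1 = (a, σ c).2) then
          ∏ i ∈ ((Finset.univ.erase m).erase (c, σ a).1).erase (a, σ c).1,
            fourTermW σ k m (i, ρ i).1 (i, ρ i).2 else 0) =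
      if ρ = σ * Equiv.swap a c then ((Equiv.Perm.sign ρ : ℤ) : ℂ) else 0 := by
    intro ρ
    dsimp only
    rw [prod_fourTermW_apply_perm σ hkm, ← ite_and, mul_boole]
    simp only [and_assoc]
    exact if_congr (swapped_compat_fixed_iff σ hac hak ham hck hcm hkm ρ) rfl rfl
  simp_rw [hterm]
  rw [Finset.sum_ite_eq' Finset.univ, if_pos (Finset.mem_univ _), Equiv.Perm.sign_mul,
    Equiv.Perm.sign_swap hac]
  push_cast
  ring

/-- **`Xᵀ·Hess(∂_{(m,σm)} det_n)(w_{σ,k,m})·X = −2·sgn σ`** for `X = X_{σ,a,c}`.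
[cite: LandsbergManivelRessayre2013, Lemma 3.4.1 (p. 479)] -/
theorem dotProduct_hessianMatrix_pderiv_detPoly_fourTerm (hac : a ≠ c) (hak : a ≠ k) (ham : a ≠ m)
    (hck : c ≠ k) (hcm : c ≠ m) (hkm : k ≠ m) :
    (fun p : Fin n × Fin n => fourTermX σ a c k m p.1 p.2) ⬝ᵥ
        (hessianMatrix (pderiv (m, σ m) (detPoly (Fin n) ℂ)) (fun p => fourTermW σ k m p.1 p.2) *ᵥ
          fun p => fourTermX σ a c k m p.1 p.2) =
      -2 * ((Equiv.Perm.sign σ : ℤ) : ℂ) := by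
  classical
  set H := hessianMatrix (pderiv (m, σ m) (detPoly (Fin n) ℂ))
    (fun p : Fin n × Fin n => fourTermW σ k m p.1 p.2) with hH
  set Xv : Fin n × Fin n → ℂ := fun p => fourTermX σ a c k m p.1 p.2 with hXv
  have hX : ∀ p : Fin n × Fin n, Xv p = if p = (a, σ c) ∨ p = (c, σ a) then 1 else 0 := by
    rintro ⟨i, j⟩
    rw [hXv]
    dsimp only
    rw [fourTermX_apply σ hac hak ham hck hcm hkm]
    simp only [Prod.mk.injEq]
    by_cases h1 : i = a <;> by_cases h2 : i = c <;> simp [h1, h2, hac, Ne.symm hac, eq_comm]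
  have hne : ((a, σ c) : Fin n × Fin n) ≠ (c, σ a) := fun h => hac (Prod.mk.inj h).1
  -- reduce the double sum to the four entries on `{(a,σc), (c,σa)}`
  have hsum : ∀ g : Fin n × Fin n → ℂ, ∑ p, Xv p * g p = g (a, σ c) + g (c, σ a) := by
    intro g
    simp_rw [hX, boole_mul]
    exact sum_ite_eq_or hne g
  have hinner : ∀ u, (H *ᵥ Xv) u = H u (a, σ c) + H u (c, σ a) := by
    intro u
    simp only [Matrix.mulVec, dotProduct]
    simp_rw [mul_comm (H u _) (Xv _)]
    exact hsum (H u)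
  rw [dotProduct]
  simp_rw [hinner]
  have hout := hsum (fun u => H u (a, σ c) + H u (c, σ a))
  beta_reduce at hout
  rw [hout, hH, hessianMatrix_pderiv_detPoly_apply_self, hessianMatrix_pderiv_detPoly_apply_self,
    hessianMatrix_pderiv_detPoly_fourTerm_offDiag σ hac hak ham hck hcm hkm,
    hessianMatrix_pderiv_detPoly_fourTerm_offDiag σ (Ne.symm hac) hck hcm hak ham hkm]
  ring

end OrbitVector

/-! ### Lemma 3.4.1 and Prop. 3.4.2 -/

section FourTerm

/-- `X_{σ,a,c}` has no entry at `(k, σ(k))`. [cite: LandsbergManivelRessayre2013, Lemma 3.4.1 (p. 479)] -/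
theorem fourTermX_apply_k (σ : Equiv.Perm (Fin n)) {a c k m : Fin n} (hac : a ≠ c) (hak : a ≠ k)
    (ham : a ≠ m) (hck : c ≠ k) (hcm : c ≠ m) (hkm : k ≠ m) : fourTermX σ a c k m k (σ k) = 0 := by
  rw [fourTermX_apply σ hac hak ham hck hcm hkm, if_neg]
  rintro (⟨h, -⟩ | ⟨h, -⟩)
  · exact hak h.symm
  · exact hck h.symm

/-- **Landsberg–Manivel–Ressayre 2013, Lemma 3.4.1** (journal p. 479; arXiv `p0008.txt:L9–16`),
verbatim: "Suppose that `IM_λ` belongs to `T̂_{[det_n]}𝒟ual_{2n−2,n,n²}`. Then for any permutation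
`σ`, and any triple of distinct integers `i,p,q` smaller than `n`, one has the relations
`Σ_{τ ∈ ⟨(ip),(qn)⟩} χ_λ(στ) = 0`. … since the characters are class functions, `ipqn` can be replaced
by any four-tuple of distinct integers." Typed with an arbitrary four-tuple `a, c, k, m` of
pairwise distinct indices (`n ≥ 3`, the scope of the scheme; four distinct indices force `n ≥ 4`):
`χ_λ(σ) + χ_λ(σ(ac)) + χ_λ(σ(km)) + χ_λ(σ(ac)(km)) = 0`.

PROOF (ours — a rigorous replacement of the printed coefficient argument, see the module
docstring): at the corank-one point `w = w_{σ,k,m}` with kernel vector `X = X_{σ,a,c}` of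
`Hess det_n(w)`, LMR Lemma 3.3.2 (`exists_hessianQuadratic_eq_mul_eval_of_mem_lmrZariskiTangent_detPoly`)
gives a constant `c_{X,w}` with `Xᵀ·H_π(w)·X = c_{X,w}·π(w)` for every tangent vector `π`; the orbit
tangent vector `π₁ = x_{kσ(k)}·∂_{(m,σm)}det_n ∈ 𝔤𝔩·det_n ⊆ T̂` has `π₁(w) = sgn σ` and
`Xᵀ·H_{π₁}(w)·X = −2·sgn σ`, so `c_{X,w} = −2`; and `IM_λ(w) = χ(σ) + χ(σ(km))`,
`Xᵀ·H_{IM_λ}(w)·X = 2(χ(σ(ac)) + χ(σ(ac)(km)))`. [cite: LandsbergManivelRessayre2013, Lemma 3.4.1 (p. 479)] -/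
theorem LMR2013_lemma_3_4_1 (hn : 3 ≤ n) (lam : Nat.Partition n)
    (hT : immanant lam ∈ lmrZariskiTangent (σ := Fin n × Fin n) (2 * n - 2) n (detPoly (Fin n) ℂ))
    (σ : Equiv.Perm (Fin n)) {a c k m : Fin n} (hac : a ≠ c) (hak : a ≠ k) (ham : a ≠ m)
    (hck : c ≠ k) (hcm : c ≠ m) (hkm : k ≠ m) :
    spechtCharacter ℂ lam σ + spechtCharacter ℂ lam (σ * Equiv.swap a c) +
        spechtCharacter ℂ lam (σ * Equiv.swap k m) +
      spechtCharacter ℂ lam (σ * Equiv.swap a c * Equiv.swap k m) = 0 := by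
  classical
  obtain ⟨cst, hc⟩ := exists_hessianQuadratic_eq_mul_eval_of_mem_lmrZariskiTangent_detPoly hn
    (fourTermW σ k m) (fourTermX σ a c k m) (rank_fourTermW σ hkm)
    (hessianMatrix_detPoly_fourTermW_mulVec_fourTermX σ (by omega) hac ham hcm hkm)
  -- the orbit tangent vector pins the constant: `c = −2`
  have hπ₁ : X (k, σ k) * pderiv (m, σ m) (detPoly (Fin n) ℂ) ∈
      lmrZariskiTangent (σ := Fin n × Fin n) (2 * n - 2) n (detPoly (Fin n) ℂ) :=
    glTangent_detPoly_subset_lmrZariskiTangent hn (Submodule.subset_span ⟨(m, σ m), (k, σ k), rfl⟩)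
  have hX0 : (fun p : Fin n × Fin n => fourTermX σ a c k m p.1 p.2) (k, σ k) = 0 :=
    fourTermX_apply_k σ hac hak ham hck hcm hkm
  have h1 := hc _ hπ₁
  rw [dotProduct_hessianMatrix_X_mul_mulVec (k, σ k) _ _ _ hX0] at h1
  simp only [fourTermW_apply_k σ hkm, one_mul,
    dotProduct_hessianMatrix_pderiv_detPoly_fourTerm σ hac hak ham hck hcm hkm,
    eval_fourTermW_orbitVector σ hkm] at h1
  have hsgn : ((Equiv.Perm.sign σ : ℤ) : ℂ) ≠ 0 := by
    rcases Int.units_eq_one_or (Equiv.Perm.sign σ) with h | h <;> simp [h]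
  have hcst : cst = -2 := (mul_right_cancel₀ hsgn h1).symm
  -- the immanant
  have h2 := hc _ hT
  rw [dotProduct_hessianMatrix_immanant_fourTerm σ hac hak ham hck hcm hkm,
    eval_fourTermW_immanant σ hkm, hcst] at h2
  linear_combination h2 / 2

/-- **Lemma 3.4.1 as membership in `C_n`**: for `n ≥ 4`, if `IM_λ ∈ T̂_{[det_n]}𝒟ual_{2n−2,n,n²}`
then `χ_λ` is a four-term class function (`fourTermClassFunctions`, val-lit-p8's
`SymmetricGroupFourTermClassFunctions.lean`). [cite: LandsbergManivelRessayre2013, Lemma 3.4.1 (p. 479)] -/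
theorem spechtCharacter_mem_fourTermClassFunctions_of_immanant_mem (hn : 4 ≤ n) (lam : Nat.Partition n)
    (hT : immanant lam ∈ lmrZariskiTangent (σ := Fin n × Fin n) (2 * n - 2) n (detPoly (Fin n) ℂ)) :
    spechtCharacter ℂ lam ∈ fourTermClassFunctions n := by
  refine ⟨fun σ τ => spechtCharacter_conj (k := ℂ) lam σ τ, fun σ i j k l hij hkl hik hil hjk hjl => ?_⟩
  exact LMR2013_lemma_3_4_1 (by omega) lam hT σ hij hik hil hjk hjl hkl

/-- **LMR 2013, Prop. 3.4.2 for `n ≥ 4`**: `IM_λ ∈ T̂_{[det_n]}𝒟ual_{2n−2,n,n²} ↔ λ ∈ {(1ⁿ), (2,1^{n−2})}`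
— `⇒` by Lemma 3.4.1 and `dim C_n = 2` (`spechtCharacter_mem_fourTermClassFunctions_iff`,
val-lit-p8), `⇐` is `LMR2013_prop_3_4_2_mpr` (val-lit-t11).
[cite: LandsbergManivelRessayre2013, Proposition 3.4.2 (p. 479)] -/
theorem LMR2013_prop_3_4_2_of_four_le (hn : 4 ≤ n) (lam : Nat.Partition n) :
    immanant lam ∈ lmrZariskiTangent (σ := Fin n × Fin n) (2 * n - 2) n (detPoly (Fin n) ℂ) ↔
      lam.parts = Multiset.replicate n 1 ∨ lam.parts = 2 ::ₘ Multiset.replicate (n - 2) 1 :=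
  ⟨fun h => (spechtCharacter_mem_fourTermClassFunctions_iff hn lam).mp
      (spechtCharacter_mem_fourTermClassFunctions_of_immanant_mem hn lam h),
    LMR2013_prop_3_4_2_mpr (by omega) lam⟩

/-- **LMR 2013, Prop. 3.4.2 — the named fact `LMR2013_prop_3_4_2` HOLDS** (`P_n = {1ⁿ, 21^{n−2}}` for
all `n ≥ 3`): `n ≥ 4` by Lemma 3.4.1 (this file) and p8's four-term class functions; `n = 3` by
val-lit-p8's kernel certificate `perPoly_not_mem_lmrZariskiTangent_three` through the assembly
`LMR2013_prop_3_4_2_of_lemma_3_4_1` (`LMR13Prop342Assembly.lean`).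
[cite: LandsbergManivelRessayre2013, Proposition 3.4.2 (p. 479)] -/
theorem LMR2013_prop_3_4_2_holds : LMR2013_prop_3_4_2 :=
  LMR2013_prop_3_4_2_of_lemma_3_4_1 fun _ hn lam h =>
    spechtCharacter_mem_fourTermClassFunctions_of_immanant_mem hn lam h

/-- **The permanent is not a Zariski tangent vector of `𝒟ual_{2n−2,n,n²}` at `[det_n]`** (`n ≥ 3`):
`per_n = IM_{(n)}` (LMR 2013 §3.4, "`[n]` is the trivial representation and `IM_{(n)}` is the
permanent", p. 478) and `(n) ∉ P_n = {1ⁿ, 21^{n−2}}` (Prop. 3.4.2). At `n = 3` this is val-lit-p8's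
kernel certificate `perPoly_not_mem_lmrZariskiTangent_three`; here for every `n ≥ 3`.
[cite: LandsbergManivelRessayre2013, Proposition 3.4.2 (p. 479)] -/
theorem perPoly_not_mem_lmrZariskiTangent (hn : 3 ≤ n) :
    perPoly (Fin n) ℂ ∉ lmrZariskiTangent (σ := Fin n × Fin n) (2 * n - 2) n (detPoly (Fin n) ℂ) := by
  intro h
  rw [← immanant_indiscrete] at h
  have hparts : (Nat.Partition.indiscrete n).parts = {n} := Nat.Partition.indiscrete_parts (by omega)
  rcases (LMR2013_prop_3_4_2_holds n hn _).mp h with h' | h'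
  · have hc := congrArg Multiset.card h'
    rw [hparts, Multiset.card_singleton, Multiset.card_replicate] at hc
    omega
  · have hc := congrArg Multiset.card h'
    rw [hparts, Multiset.card_singleton, Multiset.card_cons, Multiset.card_replicate] at hc
    omega

end FourTerm

end Literature.Computability.AlgebraicComplexity

end
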